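import Mathlib
import Summits.ResolutionOfSingularities.ResolutionOfSingularities.Theorems.WildQuotientsWildQuotientResolutionBlowupLocalExit
import Summits.ResolutionOfSingularities.ResolutionOfSingularities.Theorems.WildQuotientsWildQuotientResolutionBlowupLocalExitCharts

/-!
# The one-more-blow-up exit with charts given as open immersions (any family), and three-chart glue

Crux stmt-ResolutionOfSingularities-15640 (`WildQuotients.WildQuotientResolution`), line `Sketch`;
chain w45c, CHAIN v5 §4 «then» row of res-L1-w45c-stub-3: **V4U gluing (three pieces)**.
[OURS · L1 W4.5c] — generic glue, NOT a statement of the manuscript.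

For the `J₄` toric exit (V4U) the quotient `Y = V/σ` of `V = Bl_{I₆}𝔸⁴` is covered by THREE charts
`O/σ` (the `x₀`-, `x₁`-, `x₂`-vertex pieces), each an open immersion `gluedι O : O/σ → Y`; the centre
downstairs misses the regular `x₂`-piece and has explicit regular blow-ups on the other two. This file
turns the `n`-piece exit `hasResolution_of_isBlowup_locally_regular` (opens `U i ⊆ Y`, p486385) into
the form the assembly consumes:

* `hasResolution_of_isBlowup_local_family` — charts `f i : P i → Y` (open immersions, any index type)
  jointly surjective, and for every `i` SOME blow-up of `P i` along `𝓘.comap (f i)` regular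
  ⟹ `HasResolution Y` (transport along `P i ≅ (f i)(P i)`, `IsBlowup.comp_iso`);
* `exists_isBlowup_regular_of_comap_eq_top'` — the trivial discharge for a regular chart missing the
  centre (`𝓘.comap f = ⊤`: the identity is a regular blow-up);
* `hasResolution_of_isBlowup_local_of_isOpenImmersion₃` — the three-chart special case with one
  regular chart off the centre and two charts with regular blow-ups;
* `opensRange_gluedι_iSup_eq_top` / `opensRange_gluedι_sup₃_eq_top` — stable opens covering `X` give
  charts `gluedι` covering `X/G` (any family / three pieces).
-/

-- single-problem summit: the doubled namespace component `ResolutionOfSingularities` is forced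
set_option linter.dupNamespace false

noncomputable section

universe u

open CategoryTheory AlgebraicGeometry TopologicalSpace
open Literature.AlgebraicGeometry.Resolution Literature.AlgebraicGeometry.RelativeSpec

namespace Summit.ResolutionOfSingularities.ResolutionOfSingularities.Theorems.WildQuotientResolution.BlowupExit

/-- **A regular chart missing the centre has a regular blow-up along the restricted centre** (the
identity, a blow-up along `⊤`) — open-immersion form of `exists_isBlowup_regular_of_comap_eq_top`.
[folklore] -/
theorem exists_isBlowup_regular_of_comap_eq_top' {Y Q : Scheme.{u}} (𝓘 : Y.IdealSheafData)
    (g : Q ⟶ Y) (hQ : Scheme.IsRegular Q) (h𝓘g : 𝓘.comap g = ⊤) :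
    ∃ (B : Scheme.{u}) (p : B ⟶ Q), IsBlowup p (𝓘.comap g) ∧ Scheme.IsRegular B := by
  refine ⟨Q, 𝟙 _, ?_, hQ⟩
  rw [h𝓘g]
  exact isBlowup_id_top _

/-- **The exit with a family of charts.** `Y` integral locally Noetherian, `𝓘 ≠ ⊥`, open immersions
`f i : P i → Y` with `⨆ (f i)(P i) = Y`, and for every `i` SOME blow-up of `P i` along `𝓘.comap (f i)`
regular ⟹ `Y` has a resolution of singularities (namely any blow-up of `Y` along `𝓘`).
[cite: GortzWedhorn2020, Prop. 13.91–13.92] -/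
theorem hasResolution_of_isBlowup_local_family {Y : Scheme.{u}} [IsIntegral Y]
    [IsLocallyNoetherian Y] (𝓘 : Y.IdealSheafData) (h𝓘 : 𝓘 ≠ ⊥) {ι : Type*} {P : ι → Scheme.{u}}
    (f : ∀ i, P i ⟶ Y) [∀ i, IsOpenImmersion (f i)] (hcov : ⨆ i, (f i).opensRange = ⊤)
    (h : ∀ i, ∃ (B : Scheme.{u}) (p : B ⟶ P i), IsBlowup p (𝓘.comap (f i)) ∧ Scheme.IsRegular B) :
    Scheme.HasResolution Y := by
  refine hasResolution_of_isBlowup_locally_regular 𝓘 h𝓘 (fun i => (f i).opensRange) hcov fun i => ?_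
  obtain ⟨B, p, hp, hB⟩ := h i
  refine ⟨B, p ≫ (f i).isoOpensRange.hom, ?_, hB⟩
  have h' := hp.comp_iso (f i).isoOpensRange
  rwa [← Scheme.IdealSheafData.comap_comp, Scheme.Hom.isoOpensRange_inv_comp] at h'

/-- **Three charts: one regular off the centre, two with regular blow-ups.** `Y` integral locally
Noetherian, `𝓘 ≠ ⊥`, open immersions `f₁, f₂, g` covering `Y`, `Q` regular with `𝓘.comap g = ⊤`,
and SOME blow-up of `Pⱼ` along `𝓘.comap fⱼ` regular (`j = 1, 2`) ⟹ `HasResolution Y`. (V4U: `g` =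
the smooth `x₂`-vertex piece, `f₁, f₂` = the `μ₃`- and `μ₂`-vertex pieces of `Bl_{I₆}𝔸⁴/σ`.)
[cite: GortzWedhorn2020, Prop. 13.91–13.92] -/
theorem hasResolution_of_isBlowup_local_of_isOpenImmersion₃ {Y P₁ P₂ Q : Scheme.{u}} [IsIntegral Y]
    [IsLocallyNoetherian Y] (𝓘 : Y.IdealSheafData) (h𝓘 : 𝓘 ≠ ⊥)
    (f₁ : P₁ ⟶ Y) [IsOpenImmersion f₁] (f₂ : P₂ ⟶ Y) [IsOpenImmersion f₂]
    (g : Q ⟶ Y) [IsOpenImmersion g]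
    (hcov : f₁.opensRange ⊔ f₂.opensRange ⊔ g.opensRange = ⊤)
    (hQ : Scheme.IsRegular Q) (h𝓘g : 𝓘.comap g = ⊤)
    (hP₁ : ∃ (B : Scheme.{u}) (p : B ⟶ P₁), IsBlowup p (𝓘.comap f₁) ∧ Scheme.IsRegular B)
    (hP₂ : ∃ (B : Scheme.{u}) (p : B ⟶ P₂), IsBlowup p (𝓘.comap f₂) ∧ Scheme.IsRegular B) :
    Scheme.HasResolution Y := by
  -- the three charts as opens of `Y`, indexed by `Fin 3`
  let U : Fin 3 → Y.Opens := ![f₁.opensRange, f₂.opensRange, g.opensRange]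
  have hU : ⨆ i, U i = ⊤ := by
    rw [eq_top_iff, ← hcov]
    refine sup_le (sup_le ?_ ?_) ?_
    · exact le_iSup U 0
    · exact le_iSup U 1
    · exact le_iSup U 2
  refine hasResolution_of_isBlowup_locally_regular 𝓘 h𝓘 U hU fun i => ?_
  -- transport of `∃ regular blow-up` along `P ≅ f(P)`
  have key : ∀ {P : Scheme.{u}} (f : P ⟶ Y) [IsOpenImmersion f],
      (∃ (B : Scheme.{u}) (p : B ⟶ P), IsBlowup p (𝓘.comap f) ∧ Scheme.IsRegular B) →
      ∃ (B : Scheme.{u}) (p : B ⟶ (f.opensRange : Scheme.{u})),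
        IsBlowup p (𝓘.comap f.opensRange.ι) ∧ Scheme.IsRegular B := by
    intro P f _ hP
    obtain ⟨B, p, hp, hB⟩ := hP
    refine ⟨B, p ≫ f.isoOpensRange.hom, ?_, hB⟩
    have h' := hp.comp_iso f.isoOpensRange
    rwa [← Scheme.IdealSheafData.comap_comp, Scheme.Hom.isoOpensRange_inv_comp] at h'
  fin_cases i
  · exact key f₁ hP₁
  · exact key f₂ hP₂
  · exact key g (exists_isBlowup_regular_of_comap_eq_top' 𝓘 g hQ h𝓘g)

/-! ## Chart glue for glued quotients `X/G`: families and three pieces -/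

section Glued

variable {X S : Scheme.{u}} {r : X ⟶ S} {G : Type u} [Group G] [Finite G]
  (ρ : ActionOver r G) [S.IsSeparated] [IsSeparated r]

/-- **Stable opens covering `X` give charts covering `X/G`** (any family). [folklore] -/
theorem opensRange_gluedι_iSup_eq_top (hcov : ∀ x : X, ∃ O : ρ.StableAffineOpens, x ∈ O.1)
    {ι : Type*} (O : ι → ρ.StableAffineOpens) (h : ⨆ i, (O i).1 = ⊤) :
    ⨆ i, (ρ.gluedι (O i)).opensRange = ⊤ := by
  rw [eq_top_iff]
  rintro z -
  obtain ⟨x, rfl⟩ := ρ.gluedMk_surjective hcov z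
  have hx : x ∈ ⨆ i, (O i).1 := by
    rw [h]
    exact Opens.mem_top x
  obtain ⟨i, hi⟩ := Opens.mem_iSup.mp hx
  refine Opens.mem_iSup.mpr ⟨i, ?_⟩
  change x ∈ ρ.gluedMk hcov ⁻¹ᵁ (ρ.gluedι (O i)).opensRange
  rw [ρ.preimage_opensRange_gluedι hcov (O i)]
  exact hi

/-- **Three stable opens covering `X` give three charts covering `X/G`.** [folklore] -/
theorem opensRange_gluedι_sup₃_eq_top (hcov : ∀ x : X, ∃ O : ρ.StableAffineOpens, x ∈ O.1)
    (O₁ O₂ O₃ : ρ.StableAffineOpens) (h : O₁.1 ⊔ O₂.1 ⊔ O₃.1 = ⊤) :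
    (ρ.gluedι O₁).opensRange ⊔ (ρ.gluedι O₂).opensRange ⊔ (ρ.gluedι O₃).opensRange = ⊤ := by
  rw [eq_top_iff]
  rintro z -
  obtain ⟨x, rfl⟩ := ρ.gluedMk_surjective hcov z
  have hx : x ∈ O₁.1 ⊔ O₂.1 ⊔ O₃.1 := by
    rw [h]
    exact Opens.mem_top x
  have mem : ∀ O : ρ.StableAffineOpens, x ∈ O.1 →
      ρ.gluedMk hcov x ∈ (ρ.gluedι O).opensRange := by
    intro O hO
    change x ∈ ρ.gluedMk hcov ⁻¹ᵁ (ρ.gluedι O).opensRange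
    rw [ρ.preimage_opensRange_gluedι hcov O]
    exact hO
  rcases Opens.mem_sup.mp hx with hx | hx
  · rcases Opens.mem_sup.mp hx with hx | hx
    · exact Opens.mem_sup.mpr (Or.inl (Opens.mem_sup.mpr (Or.inl (mem O₁ hx))))
    · exact Opens.mem_sup.mpr (Or.inl (Opens.mem_sup.mpr (Or.inr (mem O₂ hx))))
  · exact Opens.mem_sup.mpr (Or.inr (mem O₃ hx))

end Glued

end Summit.ResolutionOfSingularities.ResolutionOfSingularities.Theorems.WildQuotientResolution.BlowupExit

end
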